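import Summits.BirchSwinnertonDyer.BirchSwinnertonDyer.Theorems.GenusKolyvaginAtTwoMinimalTwinBSDTwoKrizLiAnchorsByRouteWallItems
import Summits.BirchSwinnertonDyer.BirchSwinnertonDyer.Theorems.GenusKolyvaginAtTwoMinimalTwinBSDTwoKrizLiAnchor91a1RootNumber
import Summits.BirchSwinnertonDyer.BirchSwinnertonDyer.Theorems.GenusKolyvaginAtTwoMinimalTwinBSDTwoKrizLiAnchor91b1RootNumber
import Summits.BirchSwinnertonDyer.BirchSwinnertonDyer.Theorems.GenusKolyvaginAtTwoMinimalTwinBSDTwoKrizLiAnchor91a1RoadsOfModularity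
import Summits.BirchSwinnertonDyer.BirchSwinnertonDyer.Theorems.GenusKolyvaginAtTwoMinimalTwinBSDTwoKrizLiAnchor91b1RoadsOfModularity
import HarnessLib

/-!
# Route `GenusKolyvaginAtTwo`, crux U₂ `MinimalTwinBSDTwo` (stmt-BirchSwinnertonDyer-22985), LINE 23 «twin_swap»: `GenusKolyvaginAtTwoMinimalTwinBSDTwoKrizLiAnchorsByRouteWallItems` WITH THE Gross–Zagier–Kolyvagin INPUT
# DISCHARGED — every theorem of that file carrying `(hGZK : rank_eq_analyticRank_of_analyticRank_le_one)` re-issued with `(hmod : exists_isNewformOf)`, the anchors'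
# `r_an = 1` coming from their kernel root numbers (`…KrizLiAnchor<X>RootNumber.lean`, `analyticRank_<X>_of_modularity`, anchors 91a1, 91b1)

Seat `bsd-line-gk2-p2` g36 (PROVER 2/3, cell `bsd-f1-sign2`; LINE 23 holder), `--supports stmt-BirchSwinnertonDyer-22985` (helper; closes nothing).
THEOREMS ONLY (0 `def`, 0 `sorry`); standard axioms.  Pure re-issue: statements verbatim up to the one binder; the wall rows / route items and the PRINT facts stay
displayed.  **BSD is NOT proved by any of this; U₂ is NOT proved; no item is closed.**

References: [KrizLi2019] Thm 5.1 (2), Thm 4.3, §6 Table 1; [CreutzMiller2012] Thm 1.1; [CremonaAlgorithms1997] Table 1; [BCDTJAMS2001] Thm. A.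
-/

set_option autoImplicit false
-- the Theorems namespace of this sub repeats the summit name by design (D-0017 nested layout)
set_option linter.dupNamespace false

noncomputable section

open scoped Classical

open WeierstrassCurve NumberField Literature.NumberTheory.EllipticCurves
  Literature.NumberTheory.EllipticCurves.ModularForms
  Literature.NumberTheory.EllipticCurves.Rank1Residual
  Literature.NumberTheory.EllipticCurves.Rank1Residual.Typed
  Summit.BirchSwinnertonDyer.Rank1Residual
  Summit.BirchSwinnertonDyer.Rank1Residual.P2
  Literature.NumberTheory.EllipticCurves.AgasheRibetStein2006

namespace Summit.BirchSwinnertonDyer.BirchSwinnertonDyer.Theorems.GenusExact.TwinSwap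

open Summit.BirchSwinnertonDyer.BirchSwinnertonDyer.Theorems.GenusExact.TwinSwap.KrizLiAnchor91a1 in
/-- (GZK DISCHARGED: `hmod` = the Modularity Theorem `exists_isNewformOf` replaces `hGZK`; the anchor's `r_an = 1` from its kernel root number.) **The rank-one members `91a1^{(d)}` keyed BY NAME on the route item `WallSupersingularRankZeroAtTwo`** (`d ∈ 𝒩(91a1, K)`, `d_K = -55`, `χ_d(−N) = 1`):
`r_an(W₁) = 1 ∧ ¬CM ∧ BSD(W₁, 2)` modulo PRINT + that ONE route item (+ MODULARITY for the anchor's rank); witness member `91a1^{(-31)}` (`N = 87451`) included by `d := -31`.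
BSD is not proved by any of this. [cite: KrizLi2019, Thm. 5.1 (2), Thm. 4.3, §6 Table 1 (row 91a1)] [cite: CreutzMiller2012, Thm. 1.1] -/
theorem rankOneMembers_91A1_of_routeWallSS_of_modularity (hKL : KrizLi2019.thm112_bsdTwo_twist) (h33 : KrizLi2019.thm33_rank_twist)
    (htab : KrizLi2019.table1_row91a1) (hS31 : bsdTriple_of_analyticRank_le_one_of_conductor_lt)
    (hmod : exists_isNewformOf)
    (hWall : Summit.BirchSwinnertonDyer.BirchSwinnertonDyer.Theses.GenusKolyvaginAtTwo.WallSupersingularRankZeroAtTwo)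
    (K : Type) [Field K] [NumberField K] (hK : IsImaginaryQuadratic K) (hdK : NumberField.discr K = -55)
    {d : ℤ} (hd : haveI := KrizLiAnchor91a1.isGloballyMinimal_91A1; KrizLi2019.InN (⟨0, 0, 1, 1, 0⟩ : WeierstrassCurve ℚ) K d)
    (hsign : haveI := KrizLiAnchor91a1.isElliptic_91A1; Int.sign d * jacobiSym ((⟨0, 0, 1, 1, 0⟩ : WeierstrassCurve ℚ).conductorNorm ℤ) d.natAbs = 1)
    (W₁ : WeierstrassCurve ℚ) [W₁.IsElliptic] [W₁.IsGloballyMinimal]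
    (hW₁ : ∃ C : VariableChange ℚ, C • (⟨0, 0, 1, 1, 0⟩ : WeierstrassCurve ℚ).quadraticTwist (d : ℚ) = W₁) :
    W₁.analyticRank = 1 ∧ ¬ W₁.HasCM ∧ BSDp W₁ 2 :=
  KrizLiAnchor91a1.rankOneMembers_91A1_of_ssWall_of_modularity hKL h33 htab hS31 hmod (fun W _ _ h₁ h₂ h₃ => hWall W h₁ h₂ h₃) K hK hdK hd hsign W₁ hW₁

open Summit.BirchSwinnertonDyer.BirchSwinnertonDyer.Theorems.GenusExact.TwinSwap.KrizLiAnchor91b1 in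
/-- (GZK DISCHARGED: `hmod` = the Modularity Theorem `exists_isNewformOf` replaces `hGZK`; the anchor's `r_an = 1` from its kernel root number.) **The rank-one members `91b1^{(d)}` keyed BY NAME on the route item `WallSupersingularRankZeroAtTwo`** (`d ∈ 𝒩(91b1, K)`, `d_K = -55`, `χ_d(−N) = 1`):
`r_an(W₁) = 1 ∧ ¬CM ∧ BSD(W₁, 2)` modulo PRINT + that ONE route item (+ MODULARITY for the anchor's rank); witness member `91b1^{(-31)}` (`N = 87451`) included by `d := -31`.
BSD is not proved by any of this. [cite: KrizLi2019, Thm. 5.1 (2), Thm. 4.3, §6 Table 1 (row 91b1)] [cite: CreutzMiller2012, Thm. 1.1] -/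
theorem rankOneMembers_91B1_of_routeWallSS_of_modularity (hKL : KrizLi2019.thm112_bsdTwo_twist) (h33 : KrizLi2019.thm33_rank_twist)
    (htab : KrizLi2019.table1_row91b1) (hS31 : bsdTriple_of_analyticRank_le_one_of_conductor_lt)
    (hmod : exists_isNewformOf)
    (hWall : Summit.BirchSwinnertonDyer.BirchSwinnertonDyer.Theses.GenusKolyvaginAtTwo.WallSupersingularRankZeroAtTwo)
    (K : Type) [Field K] [NumberField K] (hK : IsImaginaryQuadratic K) (hdK : NumberField.discr K = -55)
    {d : ℤ} (hd : haveI := KrizLiAnchor91b1.isGloballyMinimal_91B1; KrizLi2019.InN (⟨0, 1, 1, -7, 5⟩ : WeierstrassCurve ℚ) K d)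
    (hsign : haveI := KrizLiAnchor91b1.isElliptic_91B1; Int.sign d * jacobiSym ((⟨0, 1, 1, -7, 5⟩ : WeierstrassCurve ℚ).conductorNorm ℤ) d.natAbs = 1)
    (W₁ : WeierstrassCurve ℚ) [W₁.IsElliptic] [W₁.IsGloballyMinimal]
    (hW₁ : ∃ C : VariableChange ℚ, C • (⟨0, 1, 1, -7, 5⟩ : WeierstrassCurve ℚ).quadraticTwist (d : ℚ) = W₁) :
    W₁.analyticRank = 1 ∧ ¬ W₁.HasCM ∧ BSDp W₁ 2 :=
  KrizLiAnchor91b1.rankOneMembers_91B1_of_ssWall_of_modularity hKL h33 htab hS31 hmod (fun W _ _ h₁ h₂ h₃ => hWall W h₁ h₂ h₃) K hK hdK hd hsign W₁ hW₁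

end Summit.BirchSwinnertonDyer.BirchSwinnertonDyer.Theorems.GenusExact.TwinSwap

end
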